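import Summits.ResolutionOfSingularities.ResolutionOfSingularities.Theorems.EquisingularLiftEquisingularLiftNatF102HomFrameTransition
import Literature.AlgebraicGeometry.Modules.PullbackFrame
import Literature.AlgebraicGeometry.Modules.IsoOfFrames
import HarnessLib

/-!
# [OURS · L1 W4.5(b) · LINE (T-j)-PROOF support, brick (β) framed form] Pull-back commutes with the internal Hom on a framed cover:
# `i^*𝓗om(M, N) ≅ 𝓗om(i^*M, i^*N)` when `M`, `N` carry frames on a common open cover

Cell res-hironaka, LADDER-RESOLUTION rung L, slot W4.5(b), crux chain w45b: EL♮(3) = stmt-ResolutionOfSingularities-20148, residue (T-j) = F-102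
(LINE (T-j)-PROOF brick B4 (γ*), sub-brick (β)/(β₁) of res-L1-w45b-plan-1's split 22:11:34Z / 22:38:49Z «(β₁) → 036 provisionally»; Ψ-route of
res-L1-w45b-lead-2). Seat res-D-pv-036 g11 (on-call supplier). `--supports stmt-ResolutionOfSingularities-20148 --as helper`. NOT a statement of any
manuscript; OURS; AI-written, weaker than expert review. Definition-free; standard axioms.

THEOREM (`nonempty_pullback_sheafHom_iso_of_frames`). `g : Y ⟶ X`, `M`, `N` modules on `X` with frames `e_a : 𝒪^{J_a} ≅ M|_{U_a}`,
`w_a : 𝒪^{K_a} ≅ N|_{U_a}` (finite index types) on a COMMON open cover `(U_a)` of `X`. Then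
`(pullback g).obj (sheafHom M N) ≅ sheafHom ((pullback g).obj M) ((pullback g).obj N)` (as a `Nonempty`). In particular for two LINE
BUNDLES framed on a common cover ((β₁)), e.g. the ideal sheaves of two sections of the F-102 curve on the (a1)/(a2) charts.

PROOF. Both sides are framed on the cover `g⁻¹U_a` with the SAME index `J_a × K_a`: the left by `pullbackFrame g (homFrame e_a w_a)`, the right
by `homFrame (pullbackFrame g e_a) (pullbackFrame g w_a)`; their transition matrices agree — both equal `g♯` applied entrywise to
`T(e_b, e_a)ᵀ ⊗ T(w_a, w_b)` by `transition_pullbackFrame` (tree `Modules/PullbackFrame`) and the Kronecker rule `F102.transition_homFrame`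
(`…NatF102HomFrameTransition`) — so `Modules/IsoOfFrames.isoOfFrames` glues the local comparisons. [cite: Hartshorne1977, II Ex. 5.1, II Ex. 5.18]
[folklore]
-/

noncomputable section

open CategoryTheory AlgebraicGeometry Opposite TopologicalSpace
open Literature.AlgebraicGeometry.Modules Literature.AlgebraicGeometry.Motives

set_option linter.dupNamespace false

namespace Summit.ResolutionOfSingularities.ResolutionOfSingularities.Cruxes.EquisingularLiftNat.F102

universe u

variable {X Y : Scheme.{u}} (g : Y ⟶ X)

/-- **Pulled-back transition entries, flexible opens**: for frames `e`, `e′` of `E` on `U`, `W` and any open `Z` mapping to `U` and `W`,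
the `g♯`-image in `Γ(Y, V)` (`V ≤ g⁻¹Z`, `V ≤ g⁻¹U`, `V ≤ g⁻¹W`) of the transition entry `T(e, e′)_{ij}` over `Z` is the transition entry of
the pulled-back frames over `V` (tree `transition_pullbackFrame`, which is the case `Z = U ⊓ W`, plus `transition_map`). [folklore] -/
theorem appLE_transition_eq_transition_pullbackFrame {E : X.Modules} {U W Z : X.Opens} {I I' : Type u} [Fintype I] [Fintype I']
    (e : SheafOfModules.free I ≅ E.over U) (e' : SheafOfModules.free I' ≅ E.over W) (kU : Z ⟶ U) (kW : Z ⟶ W)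
    {V : Y.Opens} (lZ : V ≤ g ⁻¹ᵁ Z) (k : V ⟶ g ⁻¹ᵁ U) (k' : V ⟶ g ⁻¹ᵁ W) (i : I) (j : I') :
    g.appLE Z V lZ (transition e e' kU kW i j) = transition (pullbackFrame g e) (pullbackFrame g e') k k' i j := by
  have hZ : Z ≤ U ⊓ W := le_inf kU.le kW.le
  have l : V ≤ g ⁻¹ᵁ (U ⊓ W) := lZ.trans (Scheme.Hom.preimage_mono g hZ)
  rw [transition_pullbackFrame g e e' l k k', Matrix.map_apply]
  -- `T` over `Z` is the restriction of `T` over `U ⊓ W`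
  have hres : transition e e' kU kW = (transition e e' (homOfLE inf_le_left) (homOfLE inf_le_right)).map
      (X.presheaf.map (homOfLE hZ).op).hom := by
    rw [transition_map]
    congr 1
  rw [hres, Matrix.map_apply]
  change (X.presheaf.map (homOfLE hZ).op ≫ g.appLE Z V lZ) _ = _
  rw [Scheme.Hom.map_appLE]

/-- **(β), framed form: `i^*𝓗om(M, N) ≅ 𝓗om(i^*M, i^*N)` for modules framed on a common open cover** (in particular two line bundles,
(β₁)). [cite: Hartshorne1977, II Ex. 5.1, II Ex. 5.18] [folklore] -/
theorem nonempty_pullback_sheafHom_iso_of_frames {M N : X.Modules} {ι : Type u} (U : ι → X.Opens) (hU : iSup U = ⊤)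
    {J K : ι → Type u} [∀ a, Fintype (J a)] [∀ a, Fintype (K a)]
    (e : ∀ a, SheafOfModules.free (J a) ≅ M.over (U a)) (w : ∀ a, SheafOfModules.free (K a) ≅ N.over (U a)) :
    Nonempty ((Scheme.Modules.pullback g).obj (sheafHom M N) ≅
      sheafHom ((Scheme.Modules.pullback g).obj M) ((Scheme.Modules.pullback g).obj N)) := by
  classical
  have hU' : iSup (fun a => g ⁻¹ᵁ U a) = ⊤ := by
    rw [← Scheme.Hom.preimage_iSup, hU]
    rfl
  refine ⟨isoOfFrames (fun a => g ⁻¹ᵁ U a) (I := fun a => J a × K a)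
    (fun a => pullbackFrame g (homFrame (e a) (w a)))
    (fun a => homFrame (pullbackFrame g (e a)) (pullbackFrame g (w a))) (fun a b => ?_) hU'⟩
  ext jk jk'
  -- the right-hand side: Kronecker rule for the pulled-back frames
  rw [transition_homFrame]
  -- the left-hand side: pull back the Kronecker rule
  have l : g ⁻¹ᵁ U a ⊓ g ⁻¹ᵁ U b ≤ g ⁻¹ᵁ (U a ⊓ U b) := le_of_eq (Scheme.Hom.preimage_inf g).symm
  rw [transition_pullbackFrame g (homFrame (e a) (w a)) (homFrame (e b) (w b)) l, Matrix.map_apply, transition_homFrame,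
    map_mul]
  -- identify the two factors
  have lZ : g ⁻¹ᵁ U a ⊓ g ⁻¹ᵁ U b ≤ g ⁻¹ᵁ (U a ⊓ U b) := l
  rw [appLE_transition_eq_transition_pullbackFrame g (e b) (e a) (homOfLE inf_le_right) (homOfLE inf_le_left) lZ
      (Opens.infLERight _ _) (Opens.infLELeft _ _),
    appLE_transition_eq_transition_pullbackFrame g (w a) (w b) (homOfLE inf_le_left) (homOfLE inf_le_right) lZ
      (Opens.infLELeft _ _) (Opens.infLERight _ _)]

end Summit.ResolutionOfSingularities.ResolutionOfSingularities.Cruxes.EquisingularLiftNat.F102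

end
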